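import Literature.NumberTheory.Automorphic.ResGLnConeDictionaryCone
import Literature.NumberTheory.Automorphic.TwistedQuotientConeClass
import Summits.Langlands.Langlands.Theorems.IrreducibilityBySelfDualityHeckeEigenvalueFieldStubHomCoboundary
import HarnessLib

/-!
# A vanishing cone class restricts to an equivariant homogeneous coboundary of the arithmetic
# stabiliser of a finite-adelic coset — crux HeckeEigenvalueField (stmt-Langlands-13632), line Sketch,
# stub `stub_fam_restrict` (FAM-RESTRICT)

Namespace `Summit.Langlands.Langlands.Theorems.HeckeEigenvalueField.Res`.  Theorems only (no definition,
no named fact, no `sorry`).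

Setting (generic layer `Literature.NumberTheory.Automorphic.TwistedQuotient`): `ι : Γ →* 𝒢`, a level
`L ≤ 𝒢`, coefficients `ρ : Γ → GL(V)`, a linear action `a` of `Γ` on `W` preserving an open convex `X`,
an equivariant family `ω` of closed `(q+1)`-forms (`IsConeFormFamily`) and a base point `x₀ ∈ X`; the
homogeneous cone cochain `F(g₀, …, g_{q+1})(cL) = conePeriod (ω c) [g₀x₀, …, g_{q+1}x₀]`
(`coneCochain`) and its class `coneClass ∈ H^{q+1}(Γ, Fun(𝒢 ⧸ L, V))`.

* `restrict_coneCoboundary_of_coneClass_eq_zero` — if `coneClass = 0` then for every coset `c` and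
  every subgroup `Δ ≤ Γ` fixing `c` through `ι` there is a `ρ|Δ`-equivariant homogeneous `q`-cochain
  `b : (Fin (q+1) → Δ) → V` whose simplicial coboundary `δb(P) = ∑ᵢ (-1)ⁱ b(P ∘ succAbove i)` is the
  cone-period cochain `P ↦ conePeriod (ω c.out) [P₀x₀, …, P_{q+1}x₀]` of the single form `ω_c`.
  Proof: `coneClass_eq_zero_iff` gives an inhomogeneous `y` with `d y = F ∘ partialProd`; the landed
  HOM-COB stub `stub_homogeneous_of_inhomogeneous_coboundary` (with `A = coeffRep ι L ρ`, `F` the cone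
  cochain, equivariant by `coneCochain_equivariant`) gives an equivariant homogeneous `H` with `F = δH`;
  put `b(g) = H(g)(c)` (Shapiro restriction): equivariance because `Δ` fixes `c` in the twisted action
  `(γ • f)(c') = ρ(γ) f(ι γ⁻¹ • c')` (`coeffRepresentation_apply`), and `δ` commutes with evaluation at `c`.
* `stub_fam_restrict` — the registered stub: the case `Γ = GL_n(K)⁺`, `ι = diagPos`, `L = K_f(𝔫)`,
  `ρ = E_λ`, `a = coneActionRat`, `X` the positive hermitian cone, `x₀ = 1`, `ω_c = coneForm η c`, and
  `Δ = Stab(c).comap diagPos` the arithmetic stabiliser of the coset `c`.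

## References

* K. S. Brown, *Cohomology of Groups*, GTM 87 (1982), III §1 and §5. [Brown1982CohomologyGroups]
* J. L. Dupont, *Simplicial de Rham cohomology and characteristic classes of flat bundles*,
  Topology 15 (1976), §1–2. [Dupont1976]
* A. Borel, N. Wallach, *Continuous cohomology, discrete subgroups, and representations of reductive
  groups*, 2nd ed. (2000), VII 2.2. [BorelWallach2000]
-/

set_option linter.dupNamespace false -- project-wide: `Summit.Langlands.Langlands` is the mandated namespace

noncomputable section

open NumberField
open Literature.NumberTheory.Automorphic Literature.NumberTheory.Automorphic.TwistedQuotient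
open Literature.Analysis.Calculus

namespace Summit.Langlands.Langlands.Theorems.HeckeEigenvalueField.Res

/-- **Shapiro restriction of a vanishing cone class.**  If the cone class of an equivariant family of
closed `(q+1)`-forms vanishes, then for every coset `c ∈ 𝒢 ⧸ L` and every subgroup `Δ ≤ Γ` fixing `c`
(through `ι`) there is a `ρ|Δ`-equivariant homogeneous `q`-cochain `b` of `Δ` with values in `V` whose
simplicial coboundary is the cone-period cochain of the single form `ω_c` over the straight simplices
`[P₀ x₀, …, P_{q+1} x₀]`: `b(g) = H(g)(c)` for the equivariant homogeneous `H` with `coneCochain = δH`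
supplied by `coneClass_eq_zero_iff` and `stub_homogeneous_of_inhomogeneous_coboundary`.
[cite: Brown1982CohomologyGroups, III §1 and §5] [cite: Dupont1976, §1–2] -/
theorem restrict_coneCoboundary_of_coneClass_eq_zero
    {Γ 𝒢 : Type} [Group Γ] [Group 𝒢] {ι : Γ →* 𝒢} {L : Subgroup 𝒢}
    {V : Type} [NormedAddCommGroup V] [NormedSpace ℂ V] [CompleteSpace V] {ρ : Representation ℂ Γ V}
    {W : Type} [NormedAddCommGroup W] [NormedSpace ℝ W] {a : Γ →* (W →L[ℝ] W)} {X : Set W} {q : ℕ}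
    {ω : 𝒢 → W → W [⋀^Fin (q + 1)]→L[ℝ] V} {x₀ : W}
    (hω : IsConeFormFamily ι L ρ a X ω) (hx₀ : x₀ ∈ X) (hcls : coneClass hω hx₀ = 0)
    (c : 𝒢 ⧸ L) (Δ : Subgroup Γ) (hΔ : ∀ δ : Δ, ι (δ : Γ) • c = c) :
    ∃ b : (Fin (q + 1) → Δ) → V,
      (∀ (γ : Δ) (g : Fin (q + 1) → Δ), b (fun i => γ * g i) = ρ (γ : Γ) (b g)) ∧
      ∀ P : Fin (q + 2) → Δ,
        conePeriod (q + 1) (ω c.out) (fun i => a (P i : Γ) x₀) =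
          ∑ i : Fin (q + 2), ((-1 : ℂ) ^ (i : ℕ)) • b (fun j => P (i.succAbove j)) := by
  -- `coneClass = 0`: the inhomogeneous cone cocycle is a coboundary `d y`
  obtain ⟨y, hy⟩ := (coneClass_eq_zero_iff hω hx₀).1 hcls
  -- the cone cochain is equivariant for the twisted coefficient module `Fun(𝒢 ⧸ L, V)`
  have hF : ∀ (γ : Γ) (g : Fin (q + 2) → Γ), coneCochain L a ω x₀ (fun i => γ * g i) =
      (coeffRep ι L ρ).ρ γ (coneCochain L a ω x₀ g) := fun γ g => by
    rw [coeffRep_ρ]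
    exact coneCochain_equivariant hω hx₀ γ g
  -- HOM-COB: `coneCochain = δH` for an equivariant homogeneous `H`
  obtain ⟨H, hHeq, hHδ⟩ : ∃ H : (Fin (q + 1) → Γ) → ((𝒢 ⧸ L) → V),
      (∀ (γ : Γ) (g : Fin (q + 1) → Γ), H (fun i => γ * g i) = coeffRepresentation ι L ρ γ (H g)) ∧
        ∀ P : Fin (q + 2) → Γ, coneCochain L a ω x₀ P =
          ∑ i : Fin (q + 2), (-1 : ℂ) ^ (i : ℕ) • H (fun j => P (i.succAbove j)) :=
    stub_homogeneous_of_inhomogeneous_coboundary (q := q) (coeffRep ι L ρ) (coneCochain L a ω x₀) hF y hy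
  -- Shapiro restriction `b(g) = H(g)(c)`
  refine ⟨fun g => H (fun i => (g i : Γ)) c, fun γ g => ?_, fun P => ?_⟩
  · -- `Δ` fixes `c`, so the twisted action at `c` is just `ρ`
    have hinv : (ι (γ : Γ))⁻¹ • c = c := inv_smul_eq_iff.2 (hΔ γ).symm
    have h := congrFun (hHeq (γ : Γ) fun i => (g i : Γ)) c
    rw [coeffRepresentation_apply, hinv] at h
    simpa only [Subgroup.coe_mul] using h
  · -- `δ` commutes with evaluation at `c`; unfold the cone cochain into cone periods
    have h := congrFun (hHδ fun i => (P i : Γ)) c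
    simpa only [Finset.sum_apply, Pi.smul_apply, coneCochain_apply] using h

/-- **Stub FAM-RESTRICT — a vanishing cone class restricts, on each finite-adelic coset, to a homogeneous
equivariant coboundary for the arithmetic stabiliser.**  `coneClass = 0` gives an inhomogeneous `y` with
`d y = F ∘ partialProd` (`coneClass_eq_zero_iff`), hence (landed HOM-COB `stub_homogeneous_of_inhomogeneous_coboundary`,
with `A = coeffRep ι L ρ`, `F` the cone cochain, equivariant by `coneCochain_equivariant`) a homogeneous
equivariant `Hh` with `F = δ Hh`; evaluating at the coset `c` and restricting to its stabiliser
`Γ_c = Stab(c).comap diagPos ≤ GL_n(K)⁺` (Shapiro) gives `b(g) = Hh(g)(c)`, `ρ|Γ_c`-equivariant (the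
stabiliser fixes `c` in the twisted action `(γ•f)(c') = ρ(γ) f(γ⁻¹ c')`), whose simplicial coboundary is the
cone PERIOD cochain of the single form `ω_c = coneForm η c.out` over the simplices `[γ₀·1, …, γ_{q+1}·1]`
(`coneCochain_apply`). [cite: Brown1982CohomologyGroups, III §1 and §5] [cite: Dupont1976, §1–2] -/
theorem stub_fam_restrict {n : ℕ} {K : Type} [Field K] [NumberField K]
    (hcpt : isCompact_glFiniteIntegralLevel n K) (𝔫 : Ideal (𝓞 K))
    (π : CuspidalAutomorphicRepData n K hcpt)
    (S : Finset {w : InfinitePlace K // w.IsReal}) (lam : (K →+* ℂ) → Fin n → ℤ) {q : ℕ}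
    {η : ConeDictionary.Cochain π.1 lam (q + 1)}
    (hω : TwistedQuotient.IsConeFormFamily (ResGLnCohomology.diagPos n K) (ResGLnCohomology.level n K 𝔫)
      (ResGLnCohomology.coeffRepPos ℂ n K lam)
      ((ResGLnCone.coneActionRat n K).comp (ResGLnCohomology.glTotPos n K).subtype) (ResGLnCone.posCone n K)
      (fun c H => ConeDictionary.coneForm π.1 S lam η c H))
    (hcls : TwistedQuotient.coneClass hω (ResGLnCone.hermOne_mem_posCone n K) = 0)
    (c : BigHeckeGLn.FiniteAdelicGL n K ⧸ ResGLnCohomology.level n K 𝔫) :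
    ∃ b : (Fin (q + 1) → ((MulAction.stabilizer (BigHeckeGLn.FiniteAdelicGL n K) c).comap
        (ResGLnCohomology.diagPos n K))) → ResGLnCohomology.CoeffModule ℂ n K lam,
      (∀ (γ : (MulAction.stabilizer (BigHeckeGLn.FiniteAdelicGL n K) c).comap (ResGLnCohomology.diagPos n K))
          (g : Fin (q + 1) → (MulAction.stabilizer (BigHeckeGLn.FiniteAdelicGL n K) c).comap
            (ResGLnCohomology.diagPos n K)),
          b (fun i => γ * g i) = ResGLnCohomology.coeffRepPos ℂ n K lam (γ : ResGLnCohomology.glTotPos n K) (b g)) ∧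
      ∀ P : Fin (q + 2) → (MulAction.stabilizer (BigHeckeGLn.FiniteAdelicGL n K) c).comap
          (ResGLnCohomology.diagPos n K),
        Literature.Analysis.Calculus.conePeriod (q + 1) (fun H => ConeDictionary.coneForm π.1 S lam η c.out H)
            (fun i => ResGLnCone.coneActionRat n K
              (((P i : ResGLnCohomology.glTotPos n K) : GL (Fin n) K)) (ResGLnCone.hermOne n K)) =
          ∑ i : Fin (q + 2), ((-1 : ℂ) ^ (i : ℕ)) • b (fun j => P (i.succAbove j)) := by
  exact restrict_coneCoboundary_of_coneClass_eq_zero hω (ResGLnCone.hermOne_mem_posCone n K) hcls c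
    ((MulAction.stabilizer (BigHeckeGLn.FiniteAdelicGL n K) c).comap (ResGLnCohomology.diagPos n K))
    fun δ => MulAction.mem_stabilizer_iff.1 (Subgroup.mem_comap.1 δ.2)

end Summit.Langlands.Langlands.Theorems.HeckeEigenvalueField.Res

end
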